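import Literature.MathematicalPhysics.QuantumLattice.HubbardFermiSeaCellRows
import Literature.MathematicalPhysics.QuantumLattice.HubbardFermiSeaTangentRows
import Literature.MathematicalPhysics.QuantumLattice.HubbardFermiSeaTangentRowsQuarterFilling
import HarnessLib

/-!
# Kernel-checked TANGENT Fermi-sea rows + POINT rows on the cuprate `t'`-columns `{-3/10, -1/4, -1/5}` at quarter and three-quarter filling

Family `hubbard` (topic `MathematicalPhysics/QuantumLattice`; companion of `HubbardFermiSeaCellRows` §3c / §4, of
`HubbardFermiSeaTangentRows` (hubbard-tc-mod-3: columns `t' ∈ {-1/2, -2/5, -3/10}`) and of `HubbardFermiSeaSheets`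
(hubbard-box-eng-1 g2: `t' ∈ {0, -1/4, …}`)). Written 2026-08-28 by `hubbard-box-p3` (g25, cell hubbard-fast, MO-S2 «t′-direction / joint cells») with hubbard-box-eng-1's generator UNCHANGED
(spec `-3/10:1/2,3/4;-1/4:3/4;-1/5:1/2,3/4`), for the weak-coupling `(t′, U)`-CELL editions of the phase-separation-exclusion sentences on the cuprate
`t′`-range `[-3/10, -1/5]` (`Summits/Ventures/CertifiedManyBodySolver/Observables/PhaseSeparationExclusionTPrimeCellsWeakFree.lean`): the premise-free
floors at `n = 1/2` (and `3/4`) at the cell's `t′`-endpoints, which the tree did not hold (`HubbardFermiSeaCellRows` §5 has `n ∈ {4/5, 7/8, 1}` there,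
`HubbardFermiSeaTangentRowsQuarterFilling` only `(−1/4, 1/2)`).
Each row is the AFFINE minorant `S + μ·n ≤ e(1, t', U, n)` — valid for every `U ≥ 0` and every REAL density `0 ≤ n < 2` —
obtained from `HubbardFermiSeaCellRows.energyDensityTT'_one_ge_affine_cellTable64` (the §3 cell sum on the `M = 64` tables of §4,
density a real parameter; at fixed `μ` the bathtub bound `μ n + 2(2π)⁻² ∫ min(ε − μ, 0)` is affine in `n`, the tangent of the convex
free-gas energy `n ↦ e(1, t', 0, n)` when `μ` is its slope; `e(1,t',U,n) ≥ e(1,t',0,n)` for `U ≥ 0`). The slope `μ ∈ ℤ/4096`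
maximises the `M = 64` cell bound `S(μ) + μ·n₀` at the TOUCH density `n₀` (the bound is concave in `μ`; coarse-to-fine scan with the
`±1/4096` neighbours certified not better); `S` is the outward (downward) 10-decimal of `S(μ)`. Generator: the exact-rational replica
`pub/hubbard-fast/hubbard-box-eng-1/code/fs_tangent_rows.py` (parses the four §4 tables from the tree file; every row re-checked here by ONE
kernel `decide`). As LP rows: `K₁(ω) + t'·K₂(ω) ≥ S + μ·n` for every torus limit `ω` of unit density-`n` vectors (cut-row shape of
`HubbardFermiSeaCornerRows`). Rows (t', n₀, μ, S, floor at n₀) — the rows `(-3/10, 1/2)`, `(-1/5, 1/2)` (`HubbardFermiSeaTangentRowsQuarterFilling`, hubbard-box-p1) and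
`(-3/10, 3/4)` (`HubbardFermiSeaTangentRows`, hubbard-tc-mod-3) already exist with IDENTICAL constants and are only re-read here as POINT corollaries; NEW tangent rows = `(-1/4, 3/4)`, `(-1/5, 3/4)`:
* `(-3/10, 1/2)`: μ = -6579/4096, S = -0.2851750245, floor -1.0882756104
* `(-3/10, 3/4)`: μ = -4847/4096, S = -0.5402682904, floor -1.4277804974
* `(-1/4, 3/4)`: μ = -4255/4096, S = -0.6647070940, floor -1.4438208635
* `(-1/5, 1/2)`: μ = -6307/4096, S = -0.3916865445, floor -1.1615840054
* `(-1/5, 3/4)`: μ = -1881/2048, S = -0.7744361313, floor -1.4632789047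
HONEST SCOPE: one-body (U = 0) floors; their merit is «kernel, uniform in U ≥ 0, affine in n»; they are ≈ 0.5–0.9·t below the
interacting energies at U = 8 and serve as U = 0 anchors of concavity chords / as LP cut rows, nothing more. No definition, no
sorry, zero compute beyond the kernel `decide`s. [cite: LiebLoss1993, §8, Theorem 8.2] [cite: BachLiebSolovej1994, eq. (2c.36)]
-/

namespace Literature.MathematicalPhysics.QuantumLattice

open ThermodynamicLimit





/-! ### Column `t' = -1/4` -/

/-- **Tangent Fermi-sea row at `t' = -1/4`, touching at `n₀ = 3/4`** (kernel-checked, `M = 64`, `μ = -4255/4096`):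
`-0.6647070940 + (-4255/4096)·n ≤ e(1, -1/4, U, n)` for every `U ≥ 0` and every real `0 ≤ n < 2`; at `n₀ = 3/4` the
floor is `-1.4438208635`. As an LP row: `K₁(ω) + (-1/4)·K₂(ω) ≥ -0.6647070940 + (-4255/4096)·n` for every torus limit `ω` of unit
density-`n` vectors. [cite: LiebLoss1993, §8, Theorem 8.2] -/
theorem fermiSeaTangentRow_tPrime_neg_one_div_four_at_three_div_four {U : ℝ} (hU : 0 ≤ U) {n : ℝ} (hn0 : 0 ≤ n) (hn2 : n < 2) :
    (-0.6647070940 : ℝ) + (-4255 / 4096) * n ≤ energyDensityTT' 1 (-1 / 4) U n := by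
  have h := energyDensityTT'_one_ge_affine_cellTable64 (-1 / 4) (-4255 / 4096) (-332353547 / 500000000)
    (by norm_num) _ _ _ _ rfl rfl rfl rfl ?_ hU hn0 hn2
  · have e1 : (((-1 / 4) : ℚ) : ℝ) = (-1 / 4 : ℝ) := by norm_num
    have e2 : (((-4255 / 4096) : ℚ) : ℝ) = (-4255 / 4096 : ℝ) := by norm_num
    have e3 : (((-332353547 / 500000000) : ℚ) : ℝ) = (-0.6647070940 : ℝ) := by norm_num
    rw [e1, e2, e3] at h
    exact h
  · decide +kernel

/-! ### Column `t' = -1/5` (NEW tangent row at `n₀ = 3/4`; the `n₀ = 1/2` row is `HubbardFermiSeaTangentRowsQuarterFilling`'s) -/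


/-- **Tangent Fermi-sea row at `t' = -1/5`, touching at `n₀ = 3/4`** (kernel-checked, `M = 64`, `μ = -1881/2048`):
`-0.7744361313 + (-1881/2048)·n ≤ e(1, -1/5, U, n)` for every `U ≥ 0` and every real `0 ≤ n < 2`; at `n₀ = 3/4` the
floor is `-1.4632789047`. As an LP row: `K₁(ω) + (-1/5)·K₂(ω) ≥ -0.7744361313 + (-1881/2048)·n` for every torus limit `ω` of unit
density-`n` vectors. [cite: LiebLoss1993, §8, Theorem 8.2] -/
theorem fermiSeaTangentRow_tPrime_neg_one_div_five_at_three_div_four {U : ℝ} (hU : 0 ≤ U) {n : ℝ} (hn0 : 0 ≤ n) (hn2 : n < 2) :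
    (-0.7744361313 : ℝ) + (-1881 / 2048) * n ≤ energyDensityTT' 1 (-1 / 5) U n := by
  have h := energyDensityTT'_one_ge_affine_cellTable64 (-1 / 5) (-1881 / 2048) (-7744361313 / 10000000000)
    (by norm_num) _ _ _ _ rfl rfl rfl rfl ?_ hU hn0 hn2
  · have e1 : (((-1 / 5) : ℚ) : ℝ) = (-1 / 5 : ℝ) := by norm_num
    have e2 : (((-1881 / 2048) : ℚ) : ℝ) = (-1881 / 2048 : ℝ) := by norm_num
    have e3 : (((-7744361313 / 10000000000) : ℚ) : ℝ) = (-0.7744361313 : ℝ) := by norm_num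
    rw [e1, e2, e3] at h
    exact h
  · decide +kernel

/-! ### Point corollaries (the `fermiSeaCellRow_…` naming of `HubbardFermiSeaCellRows` §5; 10-dp downward) -/

/-- **Point row at `(t', n) = (-3/10, 1/2)`** (corollary of `fermiSeaTangentRow_tPrime_neg_three_div_ten_at_one_div_two` at `n = 1/2`, 10-dp downward):
`-1.0882756105 ≤ e(1, -3/10, U, 1/2)` for every `U ≥ 0` (premise-free; `M = 64` cell bound, ≈ 2–3·10⁻³ outward). [cite: LiebLoss1993, §8, Theorem 8.2] -/
theorem fermiSeaCellRow_tPrime_neg_three_div_ten_density_one_div_two {U : ℝ} (hU : 0 ≤ U) :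
    (-1.0882756105 : ℝ) ≤ energyDensityTT' 1 (-3 / 10) U (1 / 2) := by
  have h := fermiSeaTangentRow_tPrime_neg_three_div_ten_at_one_div_two hU (n := 1 / 2) (by norm_num) (by norm_num)
  norm_num at h ⊢
  linarith

/-- **Point row at `(t', n) = (-3/10, 3/4)`** (corollary of `fermiSeaTangentRow_tPrime_neg_three_div_ten_at_three_div_four` at `n = 3/4`, 10-dp downward):
`-1.4277804975 ≤ e(1, -3/10, U, 3/4)` for every `U ≥ 0` (premise-free; `M = 64` cell bound, ≈ 2–3·10⁻³ outward). [cite: LiebLoss1993, §8, Theorem 8.2] -/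
theorem fermiSeaCellRow_tPrime_neg_three_div_ten_density_three_div_four {U : ℝ} (hU : 0 ≤ U) :
    (-1.4277804975 : ℝ) ≤ energyDensityTT' 1 (-3 / 10) U (3 / 4) := by
  have h := fermiSeaTangentRow_tPrime_neg_three_div_ten_at_three_div_four hU (n := 3 / 4) (by norm_num) (by norm_num)
  norm_num at h ⊢
  linarith

/-- **Point row at `(t', n) = (-1/4, 3/4)`** (corollary of `fermiSeaTangentRow_tPrime_neg_one_div_four_at_three_div_four` at `n = 3/4`, 10-dp downward):
`-1.4438208636 ≤ e(1, -1/4, U, 3/4)` for every `U ≥ 0` (premise-free; `M = 64` cell bound, ≈ 2–3·10⁻³ outward). [cite: LiebLoss1993, §8, Theorem 8.2] -/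
theorem fermiSeaCellRow_tPrime_neg_one_div_four_density_three_div_four {U : ℝ} (hU : 0 ≤ U) :
    (-1.4438208636 : ℝ) ≤ energyDensityTT' 1 (-1 / 4) U (3 / 4) := by
  have h := fermiSeaTangentRow_tPrime_neg_one_div_four_at_three_div_four hU (n := 3 / 4) (by norm_num) (by norm_num)
  norm_num at h ⊢
  linarith

/-- **Point row at `(t', n) = (-1/5, 1/2)`** (corollary of `fermiSeaTangentRow_tPrime_neg_one_div_five_at_one_div_two` at `n = 1/2`, 10-dp downward):
`-1.1615840055 ≤ e(1, -1/5, U, 1/2)` for every `U ≥ 0` (premise-free; `M = 64` cell bound, ≈ 2–3·10⁻³ outward). [cite: LiebLoss1993, §8, Theorem 8.2] -/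
theorem fermiSeaCellRow_tPrime_neg_one_div_five_density_one_div_two {U : ℝ} (hU : 0 ≤ U) :
    (-1.1615840055 : ℝ) ≤ energyDensityTT' 1 (-1 / 5) U (1 / 2) := by
  have h := fermiSeaTangentRow_tPrime_neg_one_div_five_at_one_div_two hU (n := 1 / 2) (by norm_num) (by norm_num)
  norm_num at h ⊢
  linarith

/-- **Point row at `(t', n) = (-1/5, 3/4)`** (corollary of `fermiSeaTangentRow_tPrime_neg_one_div_five_at_three_div_four` at `n = 3/4`, 10-dp downward):
`-1.4632789048 ≤ e(1, -1/5, U, 3/4)` for every `U ≥ 0` (premise-free; `M = 64` cell bound, ≈ 2–3·10⁻³ outward). [cite: LiebLoss1993, §8, Theorem 8.2] -/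
theorem fermiSeaCellRow_tPrime_neg_one_div_five_density_three_div_four {U : ℝ} (hU : 0 ≤ U) :
    (-1.4632789048 : ℝ) ≤ energyDensityTT' 1 (-1 / 5) U (3 / 4) := by
  have h := fermiSeaTangentRow_tPrime_neg_one_div_five_at_three_div_four hU (n := 3 / 4) (by norm_num) (by norm_num)
  norm_num at h ⊢
  linarith

end Literature.MathematicalPhysics.QuantumLattice
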